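import Mathlib.Analysis.SpecialFunctions.Pow.Real
import Mathlib.Analysis.SpecialFunctions.Pow.Asymptotics
import Mathlib.Analysis.SpecialFunctions.Pow.NthRootLemmas
import Mathlib.Order.Filter.AtTopBot.Basic
import Mathlib.Data.ENat.Basic
import Literature.Computability.AlgebraicComplexity.ValiantClasses
import HarnessLib

/-!
# Growth bookkeeping: exponentially bounded functions and `⌊k^{1/D}⌋` asymptotics (CplxCore)

Elementary bookkeeping for "`2^{O(n)}`" size bounds and for the coupling `n = ⌊k^{1/D}⌋` of two
parameters, of the kind complexity-theoretic proofs manipulate without comment; extracted from the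
proof of the natural proofs barrier (`Literature/Computability/Complexity/PNPNaturalProofsProofs.lean`;
Razborov–Rudich 1997, Thm. 4.1, where the generator's seed length `k` and the number of variables
`n` are coupled by `n = ⌊k^{1/D}⌋`, cf. Arora–Barak 2009, §23.3, p. 592: "the distinguisher lets
`n` be `m^{ε/2}` … in `2^{O(n)}` time, which is less than `2^{m^ε}`").

## Contents

* `IsExpBounded f` : `∃ c, ∀ n, f n ≤ 2^(c n + c)`, containing the p-bounded functions
  (`IsExpBounded.of_isPBounded`) and `2^n`, closed under `+`, `*`, `^` and under post-composition
  with p-bounded functions (`poly(2^{O(n)}) = 2^{O(n)}`, `IsExpBounded.isPBounded_comp`);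
  `le_two_pow`: `f n ≤ 2^{c n}` for `n ≥ 1`.
* `Literature.Computability.AlgebraicComplexity.IsPBounded.eventually_lt_pow`: a p-bounded function is eventually `< n^c` for
  some `c` (dot-notation extension of `IsPBounded`, `AlgebraicComplexity/ValiantClasses.lean`).
* For Mathlib's integer root `Nat.nthRoot D k = ⌊k^{1/D}⌋₊` (`Nat.pow_nthRoot_le`,
  `Nat.lt_pow_nthRoot_add_one`, `Nat.le_nthRoot_iff`): the real bound `nthRoot_le_rpow`
  (`(Nat.nthRoot D k : ℝ) ≤ k^(1/D)`), `tendsto_nthRoot`, and the punchline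
  `eventually_two_pow_nthRoot_lt`: `2^{c ⌊k^{1/D}⌋} < ⌈2^{k^ε}⌉₊` in `ℕ∞` for all large `k` once
  `1/D < ε`.

## Related declarations

Polynomial boundedness is `Literature.Computability.AlgebraicComplexity.IsPBounded` (Bürgisser's p-bounded functions,
`t n ≤ n^c + c`; working form `IsPBounded.iff_exists_le_mul_succ_pow`: `t n ≤ a (n+1)^b`, closure
API `IsPBounded.const/id/mono/add_holds/mul_holds/pow_holds/comp_holds`,
`isPBounded_iff_exists_polynomial_holds`), which this file imports and extends. A further copy,
`Literature.Computability.Cryptography.LWE.IsPolyBounded` (`∃ p : Polynomial ℕ, f ≤ p.eval`; `Cryptography/LWENoise.lean`, API in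
`Cryptography/SISFunctionSolver.lean`), is equivalent by `isPBounded_iff_exists_polynomial_holds`
but is not imported here (measure-theoretic imports). All statements are over `ℕ` (no
`Asymptotics.IsBigO`), because the consumers compare natural-number circuit sizes.
Everything is [folklore]; namespace `Literature.CplxCore`.

## References

* S. Arora, B. Barak, *Computational Complexity: A Modern Approach*, CUP 2009, §23.3, p. 592.
* A. A. Razborov, S. Rudich, *Natural proofs*, J. Comput. System Sci. 55 (1997) 24–35, proof of
  Thm. 4.1.
* P. Bürgisser, *Completeness and Reduction in Algebraic Complexity Theory*, Springer 2000,
  Def. 2.1(1) (p-bounded functions).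
-/

namespace Literature.Computability.Complexity

open Finset Filter AlgebraicComplexity

/-! ### p-bounded functions: one more API lemma -/

/-- A p-bounded function is eventually (strictly) below a fixed power: `f n < n^c` for all large
`n`, for some `c`. [folklore] -/
theorem _root_.Literature.Computability.AlgebraicComplexity.IsPBounded.eventually_lt_pow {f : ℕ → ℕ} (hf : IsPBounded f) :
    ∃ c, ∀ᶠ n in atTop, f n < n ^ c := by
  obtain ⟨C, c, hC⟩ := (IsPBounded.iff_exists_le_mul_succ_pow f).1 hf
  refine ⟨c + 1, eventually_atTop.2 ⟨C * 2 ^ c + 1, fun n hn => ?_⟩⟩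
  have hn1 : 1 ≤ n := le_trans (Nat.succ_le_succ (Nat.zero_le _)) hn
  calc f n ≤ C * (n + 1) ^ c := hC n
    _ ≤ C * (2 * n) ^ c := Nat.mul_le_mul_left _ (Nat.pow_le_pow_left (by omega) c)
    _ = C * 2 ^ c * n ^ c := by ring
    _ < n * n ^ c := Nat.mul_lt_mul_of_pos_right (by omega) (pow_pos hn1 c)
    _ = n ^ (c + 1) := by ring

/-! ### Exponentially bounded functions `ℕ → ℕ` -/

/-- `f : ℕ → ℕ` is *exponentially bounded* (`2^{O(n)}`): `f n ≤ 2^(c n + c)` for all `n`, for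
some constant `c` (the `+ c` covers `n = 0`). [folklore] -/
def IsExpBounded (f : ℕ → ℕ) : Prop := ∃ c : ℕ, ∀ n, f n ≤ 2 ^ (c * n + c)

namespace IsExpBounded

/-- p-bounded functions are exponentially bounded. [folklore] -/
theorem of_isPBounded {f : ℕ → ℕ} (hf : IsPBounded f) : IsExpBounded f := by
  obtain ⟨C, c, hC⟩ := (IsPBounded.iff_exists_le_mul_succ_pow f).1 hf
  refine ⟨C + c, fun n => ?_⟩
  have h1 : n + 1 ≤ 2 ^ n := Nat.lt_two_pow_self
  have h2 : C ≤ 2 ^ C := (Nat.lt_two_pow_self).le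
  calc f n ≤ C * (n + 1) ^ c := hC n
    _ ≤ 2 ^ C * (2 ^ n) ^ c := Nat.mul_le_mul h2 (Nat.pow_le_pow_left h1 c)
    _ = 2 ^ (C + n * c) := by rw [← pow_mul, ← pow_add]
    _ ≤ 2 ^ ((C + c) * n + (C + c)) := Nat.pow_le_pow_right (by norm_num) (by nlinarith)

/-- Constants are exponentially bounded. [folklore] -/
theorem const (C : ℕ) : IsExpBounded fun _ => C := of_isPBounded (IsPBounded.const C)

/-- `2 ^ n` is exponentially bounded. [folklore] -/
theorem two_pow : IsExpBounded fun n => 2 ^ n :=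
  ⟨1, fun n => Nat.pow_le_pow_right (by norm_num) (by omega)⟩

/-- A function below an exponentially bounded one is exponentially bounded. [folklore] -/
theorem mono {f g : ℕ → ℕ} (hg : IsExpBounded g) (h : ∀ n, f n ≤ g n) : IsExpBounded f := by
  obtain ⟨c, hc⟩ := hg
  exact ⟨c, fun n => (h n).trans (hc n)⟩

/-- Sums of exponentially bounded functions are exponentially bounded. [folklore] -/
theorem add {f g : ℕ → ℕ} (hf : IsExpBounded f) (hg : IsExpBounded g) :
    IsExpBounded fun n => f n + g n := by
  obtain ⟨a, ha⟩ := hf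
  obtain ⟨b, hb⟩ := hg
  refine ⟨a + b + 1, fun n => ?_⟩
  have h1 : 2 ^ (a * n + a) ≤ 2 ^ ((a + b) * n + (a + b)) :=
    Nat.pow_le_pow_right (by norm_num) (by nlinarith)
  have h2 : 2 ^ (b * n + b) ≤ 2 ^ ((a + b) * n + (a + b)) :=
    Nat.pow_le_pow_right (by norm_num) (by nlinarith)
  calc f n + g n ≤ 2 ^ ((a + b) * n + (a + b)) + 2 ^ ((a + b) * n + (a + b)) :=
        Nat.add_le_add ((ha n).trans h1) ((hb n).trans h2)
    _ = 2 ^ ((a + b) * n + (a + b) + 1) := by rw [pow_succ]; ring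
    _ ≤ 2 ^ ((a + b + 1) * n + (a + b + 1)) := Nat.pow_le_pow_right (by norm_num) (by nlinarith)

/-- Products of exponentially bounded functions are exponentially bounded. [folklore] -/
theorem mul {f g : ℕ → ℕ} (hf : IsExpBounded f) (hg : IsExpBounded g) :
    IsExpBounded fun n => f n * g n := by
  obtain ⟨a, ha⟩ := hf
  obtain ⟨b, hb⟩ := hg
  refine ⟨a + b, fun n => ?_⟩
  calc f n * g n ≤ 2 ^ (a * n + a) * 2 ^ (b * n + b) := Nat.mul_le_mul (ha n) (hb n)
    _ = 2 ^ ((a + b) * n + (a + b)) := by rw [← pow_add]; ring_nf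

/-- Powers of an exponentially bounded function are exponentially bounded. [folklore] -/
theorem pow {f : ℕ → ℕ} (hf : IsExpBounded f) (e : ℕ) : IsExpBounded fun n => f n ^ e := by
  obtain ⟨a, ha⟩ := hf
  refine ⟨a * e, fun n => ?_⟩
  calc f n ^ e ≤ (2 ^ (a * n + a)) ^ e := Nat.pow_le_pow_left (ha n) e
    _ = 2 ^ (a * e * n + a * e) := by rw [← pow_mul]; ring_nf

/-- A p-bounded function of an exponentially bounded one is exponentially bounded
(`poly(2^{O(n)}) = 2^{O(n)}`). [folklore] -/
theorem isPBounded_comp {f g : ℕ → ℕ} (hf : IsPBounded f) (hg : IsExpBounded g) :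
    IsExpBounded fun n => f (g n) := by
  obtain ⟨C, c, hC⟩ := (IsPBounded.iff_exists_le_mul_succ_pow f).1 hf
  have h1 : IsExpBounded fun n => g n + 1 := hg.add (const 1)
  have h2 : IsExpBounded fun n => C * (g n + 1) ^ c := (const C).mul (h1.pow c)
  exact h2.mono fun n => hC (g n)

/-- The defining bound in the form `f n ≤ 2 ^ (c n)` for `n ≥ 1`. [folklore] -/
theorem le_two_pow {f : ℕ → ℕ} (hf : IsExpBounded f) : ∃ c, ∀ n, 1 ≤ n → f n ≤ 2 ^ (c * n) := by
  obtain ⟨c, hc⟩ := hf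
  exact ⟨2 * c, fun n hn => (hc n).trans (Nat.pow_le_pow_right (by norm_num) (by nlinarith))⟩

end IsExpBounded

/-! ### The integer `D`-th root `⌊k^{1/D}⌋ = Nat.nthRoot D k`: real bound and asymptotics -/

section NthRoot

variable {D : ℕ}

/-- `Nat.nthRoot D k ≤ k^{1/D}` as real numbers (for `D = 0` both sides are `1`). [folklore] -/
theorem nthRoot_le_rpow (D k : ℕ) : (Nat.nthRoot D k : ℝ) ≤ (k : ℝ) ^ ((D : ℝ)⁻¹) := by
  rcases eq_or_ne D 0 with rfl | hD
  · simp
  · have h : ((Nat.nthRoot D k : ℝ)) ^ D ≤ (k : ℝ) := by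
      exact_mod_cast Nat.pow_nthRoot_le (Or.inl hD)
    calc (Nat.nthRoot D k : ℝ) = (((Nat.nthRoot D k : ℝ)) ^ D) ^ ((D : ℝ)⁻¹) :=
          (Real.pow_rpow_inv_natCast (Nat.cast_nonneg _) hD).symm
      _ ≤ (k : ℝ) ^ ((D : ℝ)⁻¹) := Real.rpow_le_rpow (by positivity) h (by positivity)

/-- `Nat.nthRoot D k → ∞` as `k → ∞` (for `D ≠ 0`). [folklore] -/
theorem tendsto_nthRoot (hD : D ≠ 0) : Tendsto (Nat.nthRoot D) atTop atTop :=
  tendsto_atTop_atTop.2 fun M => ⟨M ^ D, fun _ hk => (Nat.le_nthRoot_iff hD).2 hk⟩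

/-- The punchline of the parameter choice `n = ⌊k^{1/D}⌋`: `2^{c n} < 2^{k^ε}` (indeed
`< ⌈2^{k^ε}⌉₊` in `ℕ∞`) for all large `k`, since `c n ≤ c k^{1/D} < k^ε` once `1/D < ε`
(Razborov–Rudich 1997, proof of Thm. 4.1; Arora–Barak 2009, p. 592: "`2^{O(n)}` time, which is
less than `2^{m^ε}`"). [cite: AroraBarakCC2009, §23.3 p. 592] -/
theorem eventually_two_pow_nthRoot_lt {ε : ℝ} (hε : (D : ℝ)⁻¹ < ε) (c : ℕ) :
    ∀ᶠ k : ℕ in atTop,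
      ((2 ^ (c * Nat.nthRoot D k) : ℕ) : ℕ∞) < (⌈(2 : ℝ) ^ ((k : ℝ) ^ ε)⌉₊ : ℕ∞) := by
  set δ : ℝ := ε - (D : ℝ)⁻¹ with hδ
  have hδpos : 0 < δ := by rw [hδ]; linarith
  have h1 : Tendsto (fun k : ℕ => (k : ℝ) ^ δ) atTop atTop :=
    (tendsto_rpow_atTop hδpos).comp tendsto_natCast_atTop_atTop
  filter_upwards [h1.eventually_ge_atTop ((c : ℝ) + 1), eventually_ge_atTop 1] with k hk hk1
  have hkpos : (0 : ℝ) < k := by exact_mod_cast hk1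
  have hr : 0 < (k : ℝ) ^ ((D : ℝ)⁻¹) := Real.rpow_pos_of_pos hkpos _
  have hlt : ((c * Nat.nthRoot D k : ℕ) : ℝ) < (k : ℝ) ^ ε := by
    calc ((c * Nat.nthRoot D k : ℕ) : ℝ) = c * (Nat.nthRoot D k : ℝ) := by push_cast; ring
      _ ≤ c * (k : ℝ) ^ ((D : ℝ)⁻¹) := by gcongr; exact nthRoot_le_rpow D k
      _ < ((c : ℝ) + 1) * (k : ℝ) ^ ((D : ℝ)⁻¹) := by nlinarith
      _ ≤ (k : ℝ) ^ δ * (k : ℝ) ^ ((D : ℝ)⁻¹) := by gcongr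
      _ = (k : ℝ) ^ ε := by rw [← Real.rpow_add hkpos]; congr 1; rw [hδ]; ring
  have h2 : ((2 ^ (c * Nat.nthRoot D k) : ℕ) : ℝ) < (2 : ℝ) ^ ((k : ℝ) ^ ε) := by
    have := Real.rpow_lt_rpow_of_exponent_lt (by norm_num : (1 : ℝ) < 2) hlt
    rw [Real.rpow_natCast] at this
    exact_mod_cast this
  exact_mod_cast Nat.lt_ceil.2 h2

end NthRoot

end Literature.Computability.Complexity
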